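import Summits.CriticalPhenomena.PercolationContinuityZ3.Theorems.PercNearOneGluingNoHeavyLowerTailSahiOneStepCodimThree
import HarnessLib

/-!
# One-step scheme: `(2′)` at codimension three — the SYMMETRIC reduction (good pivots for EITHER partner)

Support file (prover prim-ineq-prove-3 gen 38; `--supports stmt-CriticalPhenomena-4575`; memo
`run/shared/lean/prim/prim-ineq-prove-3/FINDING-G38-PIVOT-WINDOW.md` §5).  No definitions, no named facts, no sorries; ONE explicit hypothesis.

`osN_threshold_codimThree_nonneg_of_goodPivots` (`…SahiOneStepCodimThree`) reduces `(2′)` at the slot `{N_F ≥ |F|-3}` for all pairs to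
`(hgood₃)`: a good pivot for EVERY self-hull event.  Since `n` is symmetric (`osN_comm`) and BOTH partners may be replaced by their hulls
(`osN_ind_ind_hgen_le_right` twice), the same induction runs under the weaker hypothesis `(hgood₃-sym)` of
`osN_threshold_codimThree_nonneg_of_goodPivots_pairs`: for every TWO increasing `F`-determined self-hull events `A, B ∉ {∅, univ}` (`|F| ≥ 4`)
some `e ∈ F` is a good pivot at the level `|F|-4` on `F ∖ e` for `B` OR for `A`.  A single event without good pivot does not refute this form;
only a PAIR of such events on one block would (memo §5; cf. the symmetric class induction `osN_threshold_nonneg_of_goodPivots_on_pairs`).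
-/

noncomputable section

namespace Summit.CriticalPhenomena.PercolationContinuityZ3.Theorems

namespace SahiOneStep

open Finset MeasureTheory
open Literature.Probability.Percolation (DeterminedBy determinedBy_iff)
open Literature.Probability.LatticeModels (prodBernoulli)
open Literature.Probability.Percolation.DecisionTree (ind)
open SahiE3Sections (determinedBy_section_insert determinedBy_section_sdiff)
open scoped Classical

variable {ι : Type*} [Fintype ι]

/-- **`(2′)` at codimension three for all increasing pairs determined by the block, conditionally on good pivots for EITHER of two self-hull
events.**  Since `n` is symmetric (`osN_comm`) and both partners may be replaced by their hulls (`osN_ind_ind_hgen_le_right` twice), the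
induction of `osN_threshold_codimThree_nonneg_of_goodPivots` runs with the weaker hypothesis `(hgood₃-sym)`: for every block `F` with
`|F| ≥ 4` and every TWO increasing `F`-determined self-hull events `A, B ∉ {∅, univ}` some `e ∈ F` is a good pivot at the level `|F|-4` on
`F ∖ e` for `B` OR for `A`.  (A single event without good pivot would not refute this form; a PAIR of such events on one block would.) [this work] -/
theorem osN_threshold_codimThree_nonneg_of_goodPivots_pairs (p : ι → unitInterval)
    (hgood : ∀ (F : Finset ι) (A B : Set (Set ι)), 4 ≤ F.card →
      IsUpperSet A → DeterminedBy A (↑F : Set ι) → A.Nonempty → A ≠ Set.univ → {ω : Set ι | ∀ ω' : Set ι, ω ⊆ ω' → ω' ∈ {ω : Set ι | F.card - 3 ≤ (F.filter (· ∈ ω)).card} → ω' ∈ A} = A →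
      IsUpperSet B → DeterminedBy B (↑F : Set ι) → B.Nonempty → B ≠ Set.univ → {ω : Set ι | ∀ ω' : Set ι, ω ⊆ ω' → ω' ∈ {ω : Set ι | F.card - 3 ≤ (F.filter (· ∈ ω)).card} → ω' ∈ B} = B →
      ∃ e ∈ F,
        ((prodBernoulli p).real {ω : Set ι | ((F.erase e).filter (· ∈ ω)).card < F.card - 4} *
            (prodBernoulli p).real ({ω : Set ι | ω \ {e} ∈ B} ∩ {ω : Set ι | ((F.erase e).filter (· ∈ ω)).card < F.card - 4 + 1}) ≤
          (prodBernoulli p).real {ω : Set ι | ((F.erase e).filter (· ∈ ω)).card < F.card - 4 + 1} *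
            (prodBernoulli p).real ({ω : Set ι | insert e ω ∈ B} ∩ {ω : Set ι | ((F.erase e).filter (· ∈ ω)).card < F.card - 4}) ∧
        (prodBernoulli p).real {ω : Set ι | ((F.erase e).filter (· ∈ ω)).card < F.card - 4} *
            (1 - (prodBernoulli p).real {ω : Set ι | insert e ω ∈ B}) *
            ((prodBernoulli p).real {ω : Set ι | ((F.erase e).filter (· ∈ ω)).card < F.card - 4 + 1} *
                (prodBernoulli p).real {ω : Set ι | ω \ {e} ∈ B}
              - (prodBernoulli p).real ({ω : Set ι | ω \ {e} ∈ B} ∩ {ω : Set ι | ((F.erase e).filter (· ∈ ω)).card < F.card - 4 + 1})) ≤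
          (prodBernoulli p).real {ω : Set ι | ((F.erase e).filter (· ∈ ω)).card < F.card - 4 + 1} *
            (1 - (prodBernoulli p).real {ω : Set ι | ω \ {e} ∈ B}) *
            ((prodBernoulli p).real {ω : Set ι | ((F.erase e).filter (· ∈ ω)).card < F.card - 4} *
                (prodBernoulli p).real {ω : Set ι | insert e ω ∈ B}
              - (prodBernoulli p).real ({ω : Set ι | insert e ω ∈ B} ∩ {ω : Set ι | ((F.erase e).filter (· ∈ ω)).card < F.card - 4})))
        ∨ ((prodBernoulli p).real {ω : Set ι | ((F.erase e).filter (· ∈ ω)).card < F.card - 4} *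
            (prodBernoulli p).real ({ω : Set ι | ω \ {e} ∈ A} ∩ {ω : Set ι | ((F.erase e).filter (· ∈ ω)).card < F.card - 4 + 1}) ≤
          (prodBernoulli p).real {ω : Set ι | ((F.erase e).filter (· ∈ ω)).card < F.card - 4 + 1} *
            (prodBernoulli p).real ({ω : Set ι | insert e ω ∈ A} ∩ {ω : Set ι | ((F.erase e).filter (· ∈ ω)).card < F.card - 4}) ∧
        (prodBernoulli p).real {ω : Set ι | ((F.erase e).filter (· ∈ ω)).card < F.card - 4} *
            (1 - (prodBernoulli p).real {ω : Set ι | insert e ω ∈ A}) *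
            ((prodBernoulli p).real {ω : Set ι | ((F.erase e).filter (· ∈ ω)).card < F.card - 4 + 1} *
                (prodBernoulli p).real {ω : Set ι | ω \ {e} ∈ A}
              - (prodBernoulli p).real ({ω : Set ι | ω \ {e} ∈ A} ∩ {ω : Set ι | ((F.erase e).filter (· ∈ ω)).card < F.card - 4 + 1})) ≤
          (prodBernoulli p).real {ω : Set ι | ((F.erase e).filter (· ∈ ω)).card < F.card - 4 + 1} *
            (1 - (prodBernoulli p).real {ω : Set ι | ω \ {e} ∈ A}) *
            ((prodBernoulli p).real {ω : Set ι | ((F.erase e).filter (· ∈ ω)).card < F.card - 4} *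
                (prodBernoulli p).real {ω : Set ι | insert e ω ∈ A}
              - (prodBernoulli p).real ({ω : Set ι | insert e ω ∈ A} ∩ {ω : Set ι | ((F.erase e).filter (· ∈ ω)).card < F.card - 4}))))
    (F : Finset ι) {A B : Set (Set ι)} (hA : IsUpperSet A) (hB : IsUpperSet B) (hAF : DeterminedBy A (↑F : Set ι))
    (hBF : DeterminedBy B (↑F : Set ι)) :
    0 ≤ osN p {ω : Set ι | F.card - 3 ≤ (F.filter (· ∈ ω)).card} (ind A) (ind B) := by
  induction hn : F.card using Nat.strong_induction_on generalizing F A B with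
  | _ n ih =>
  subst hn
  by_cases h4 : F.card < 4
  · rw [show F.card - 3 = 0 by omega, threshold_zero, osN_ind_ind_univ]
  push Not at h4
  have hHu : IsUpperSet {ω : Set ι | F.card - 3 ≤ (F.filter (· ∈ ω)).card} := isUpperSet_threshold F (F.card - 3)
  -- pass to the hulls `As`, `Bs` of both partners
  set As : Set (Set ι) := {ω : Set ι | ∀ ω' : Set ι, ω ⊆ ω' → ω' ∈ {ω : Set ι | F.card - 3 ≤ (F.filter (· ∈ ω)).card} → ω' ∈ A}
    with hAs
  set Bs : Set (Set ι) := {ω : Set ι | ∀ ω' : Set ι, ω ⊆ ω' → ω' ∈ {ω : Set ι | F.card - 3 ≤ (F.filter (· ∈ ω)).card} → ω' ∈ B}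
    with hBs
  have hAsu : IsUpperSet As := isUpperSet_hgen _ _
  have hBsu : IsUpperSet Bs := isUpperSet_hgen _ _
  have hAsF : DeterminedBy As (↑F : Set ι) := determinedBy_hgen (determinedBy_threshold F (F.card - 3)) hAF
  have hBsF : DeterminedBy Bs (↑F : Set ι) := determinedBy_hgen (determinedBy_threshold F (F.card - 3)) hBF
  have hAss : {ω : Set ι | ∀ ω' : Set ι, ω ⊆ ω' → ω' ∈ {ω : Set ι | F.card - 3 ≤ (F.filter (· ∈ ω)).card} → ω' ∈ As} = As := by
    rw [hAs]; exact hgen_hgen_eq _ _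
  have hBss : {ω : Set ι | ∀ ω' : Set ι, ω ⊆ ω' → ω' ∈ {ω : Set ι | F.card - 3 ≤ (F.filter (· ∈ ω)).card} → ω' ∈ Bs} = Bs := by
    rw [hBs]; exact hgen_hgen_eq _ _
  have hred : osN p {ω : Set ι | F.card - 3 ≤ (F.filter (· ∈ ω)).card} (ind As) (ind Bs) ≤
      osN p {ω : Set ι | F.card - 3 ≤ (F.filter (· ∈ ω)).card} (ind A) (ind B) := by
    refine le_trans ?_ (osN_ind_ind_hgen_le_right p hHu hA hB)
    rw [osN_comm p _ (ind As), osN_comm p _ (ind A)]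
    exact osN_ind_ind_hgen_le_right p hHu hBsu hA
  refine le_trans ?_ hred
  rcases Bs.eq_empty_or_nonempty with hBe | hBne
  · rw [hBe, osN_ind_ind_empty_right]
  by_cases hBu : Bs = Set.univ
  · rw [hBu, osN_ind_ind_univ_snd]
  rcases As.eq_empty_or_nonempty with hAe | hAne
  · rw [hAe, osN_comm, osN_ind_ind_empty_right]
  by_cases hAu : As = Set.univ
  · rw [hAu, osN_comm, osN_ind_ind_univ_snd]
  obtain ⟨e, heF, hgoodBA⟩ := hgood F As Bs h4 hAsu hAsF hAne hAu hAss hBsu hBsF hBne hBu hBss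
  -- bookkeeping of the block `F = insert e (F ∖ e)` and of the levels
  have hce : (F.erase e).card = F.card - 1 := Finset.card_erase_of_mem heF
  have hlt : (F.erase e).card < F.card := Finset.card_erase_lt_of_mem heF
  have e3 : (F.erase e).card - 3 = F.card - 4 := by rw [hce]; omega
  have e2 : (F.erase e).card - 2 = F.card - 4 + 1 := by rw [hce]; omega
  have hcoe : (↑(F.erase e) : Set ι) = (↑F : Set ι) \ {e} := Finset.coe_erase e F
  have hslot : {ω : Set ι | F.card - 3 ≤ (F.filter (· ∈ ω)).card} =
      {ω : Set ι | F.card - 4 + 1 ≤ ((insert e (F.erase e)).filter (· ∈ ω)).card} := by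
    rw [Finset.insert_erase heF, show F.card - 4 + 1 = F.card - 3 by omega]
  rw [hslot]
  rcases hgoodBA with ⟨hX, hΨ⟩ | ⟨hX, hΨ⟩
  · refine osN_threshold_goodPivot_step p (F.notMem_erase e) (F.card - 4) hAsu hBsu ?_ ?_ ?_ hX hΨ
    · have h := ih _ hlt (F.erase e) (isUpperSet_section_insert hAsu e) (isUpperSet_section_insert hBsu e)
        (by rw [hcoe]; exact determinedBy_section_insert hAsF e) (by rw [hcoe]; exact determinedBy_section_insert hBsF e) rfl
      rwa [e3] at h
    · have h := osN_threshold_codimTwo_nonneg p (F.erase e) (isUpperSet_section_insert hAsu e) (isUpperSet_section_sdiff hBsu e)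
        (by rw [hcoe]; exact determinedBy_section_sdiff hBsF e)
      rwa [e2] at h
    · have h := osN_threshold_codimTwo_nonneg p (F.erase e) (isUpperSet_section_sdiff hAsu e) (isUpperSet_section_sdiff hBsu e)
        (by rw [hcoe]; exact determinedBy_section_sdiff hBsF e)
      rwa [e2] at h
  · rw [osN_comm]
    refine osN_threshold_goodPivot_step p (F.notMem_erase e) (F.card - 4) hBsu hAsu ?_ ?_ ?_ hX hΨ
    · have h := ih _ hlt (F.erase e) (isUpperSet_section_insert hBsu e) (isUpperSet_section_insert hAsu e)
        (by rw [hcoe]; exact determinedBy_section_insert hBsF e) (by rw [hcoe]; exact determinedBy_section_insert hAsF e) rfl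
      rwa [e3] at h
    · have h := osN_threshold_codimTwo_nonneg p (F.erase e) (isUpperSet_section_insert hBsu e) (isUpperSet_section_sdiff hAsu e)
        (by rw [hcoe]; exact determinedBy_section_sdiff hAsF e)
      rwa [e2] at h
    · have h := osN_threshold_codimTwo_nonneg p (F.erase e) (isUpperSet_section_sdiff hBsu e) (isUpperSet_section_sdiff hAsu e)
        (by rw [hcoe]; exact determinedBy_section_sdiff hAsF e)
      rwa [e2] at h

end SahiOneStep

end Summit.CriticalPhenomena.PercolationContinuityZ3.Theorems
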